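import Mathlib
import Summits.ResolutionOfSingularities.ResolutionOfSingularities.Theorems.HomologicalConductorNoZenoStableAnnihilatorReduction
import Literature.RingTheory.CohomologyAnnihilator.SyzygyBaseChange
import HarnessLib

set_option linter.dupNamespace false

/-!
# Faithfully flat descent of cohomology annihilators (same index)

`[OURS · L1 w44b · ORDER w44b-o8b (res-L1-w44b-plan-1 gen 9, CHAIN v8 §V8.3)]` — helper for the
surface rung `PersistenceSurface` (stmt-ResolutionOfSingularities-19970) of the crux
`HomologicalConductor.Persistence` (stmt-ResolutionOfSingularities-16484): it supplies the DESCENT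
conjunct of the step-dual-cover interface of ORDER w44b-o8 (`StepDualCover.descent`,
«`caᵐ⁺¹(T₂) ∩ T' ⊆ caᵐ⁺¹(T')`») for the model `T₂` = a faithfully flat noetherian `T'`-algebra, e.g.
an étale neighbourhood of a local `T'`.  NOT a statement of the manuscript under adjudication in cell
res-hironaka; nothing here is attributed to its author.  Pure commutative algebra over Mathlib and
the tree's `Literature.RingTheory.CohomologyAnnihilator` library, in the vocabulary of the W4.4
CA-layer (`StablyAnnihilates`, CA1 `mem_cohomologyAnnihilatorOfDegree_succ_iff_forall_isSyzygy`).

Write `caⁿ(R)` for `cohomologyAnnihilatorOfDegree R n`, `s̲ann(M)` for the stable annihilator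
(`x ∈ s̲ann(M)` iff `x • 𝟙 M` factors through a finitely generated projective, `StablyAnnihilates`).

* **(P) presentation criterion.** For a surjection `π : F₀ ↠ M` from a finitely generated
  projective: `x ∈ s̲ann(M)` iff `x • 𝟙 M` lifts along `π`
  (`stablyAnnihilates_iff_exists_comp_eq_smul_id`); and for a presentation `F₁ →ρ F₀ →π M → 0`
  with `F₀` projective: such a lift exists iff `ρ ∘ β ∘ ρ = -x ρ` for some `β : F₀ → F₁`
  (`exists_comp_eq_smul_id_iff_exists_sandwich`).  So for finitely presented `M`, membership in
  `s̲ann(M)` is the solvability of ONE linear equation between Hom-modules of finite free modules.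
* **(D) descent of solvability.** For `S` faithfully flat over `T`, `y ∈ range Γ` as soon as
  `1 ⊗ y ∈ range (Γ ⊗ S)` (`mem_range_of_one_tmul_mem_range_baseChange`, from Mathlib's
  `Module.FaithfullyFlat.one_tmul_eq_zero_iff` on `W ⧸ range Γ`); the Hom-modules of finite free
  modules commute with base change (Mathlib `IsBaseChange.linearMapLeftRight`), compatibly with the
  sandwich map `β ↦ ρ β ρ` (`exists_sandwich_of_baseChange`).
* **(D1)** `StablyAnnihilates.of_faithfullyFlat_baseChange`: for `S` faithfully flat over `T` and `M`
  finitely presented, `algebraMap x ∈ s̲ann_S(S ⊗ M)` implies `x ∈ s̲ann_T(M)`.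
* **(D2)** `comap_cohomologyAnnihilatorOfDegree_succ_le_of_faithfullyFlat`: for `T`, `S` noetherian,
  `S` faithfully flat over `T`: `caⁿ⁺¹(S) ∩ T ⊆ caⁿ⁺¹(T)` (same index) — CA1 on both sides, flat base
  change of syzygies (tree `IsSyzygy.baseChange`) and (D1); `ca(S) ∩ T ⊆ ca(T)`
  (`comap_cohomologyAnnihilator_le_of_faithfullyFlat`).
* **(D3)** local corollaries: a FLAT LOCAL homomorphism of noetherian local rings is faithfully flat
  (Mathlib `Module.FaithfullyFlat.of_flat_of_isLocalHom`), so `caⁿ⁺¹` descends along it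
  (`comap_cohomologyAnnihilatorOfDegree_succ_le_of_flat_of_isLocalHom`); in particular along an
  ÉTALE NEIGHBOURHOOD `T' → E_𝔮` (`E` étale over local noetherian `T'`, `𝔮` over the closed point;
  `comap_cohomologyAnnihilatorOfDegree_succ_le_of_etale_neighbourhood`).

## References

* S. B. Iyengar, R. Takahashi, *Annihilation of cohomology and strong generation of module
  categories*, IMRN 2016; arXiv:1404.1476 — §2 (syzygies, `caⁿ`), Remark 2.13.
  [`IyengarTakahashi2014`]
* Descent of solvability of linear equations along faithfully flat ring maps is folklore (fpqc
  descent for modules, e.g. the injectivity of `N → S ⊗_T N`); here via Mathlib's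
  `Module.FaithfullyFlat.one_tmul_eq_zero_iff`.
-/

noncomputable section

open CategoryTheory Literature.RingTheory.CohomologyAnnihilator
open Summit.ResolutionOfSingularities.ResolutionOfSingularities.Theorems.NoZeno.SandwichCluster
open scoped TensorProduct

universe u

namespace Summit.ResolutionOfSingularities.ResolutionOfSingularities.Theorems.HomologicalConductor.PersistenceFaithfullyFlatDescent

/-! ## (P) The presentation criterion for stable annihilation -/

section Presentation

variable {T : Type u} [CommRing T] {M F₀ F₁ : Type u} [AddCommGroup M] [Module T M]
  [AddCommGroup F₀] [Module T F₀] [AddCommGroup F₁] [Module T F₁]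

/-- **Stable annihilation is lifting along one projective cover.**  For a surjection `π : F₀ ↠ M`
with `F₀` finitely generated projective, `x` stably annihilates `M` iff `x • 𝟙 M` lifts along `π`:
`π ∘ σ = x • 𝟙 M` for some `σ : M → F₀` (a factorisation `M → P → M` through any projective `P`
lifts along `π` by the lifting property of `P`). [cite: IyengarTakahashi2014, Remark 2.13] -/
theorem stablyAnnihilates_iff_exists_comp_eq_smul_id [Module.Finite T F₀] [Module.Projective T F₀]
    (x : T) (π : F₀ →ₗ[T] M) (hπ : Function.Surjective π) :
    StablyAnnihilates T x (ModuleCat.of T M) ↔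
      ∃ σ : M →ₗ[T] F₀, π ∘ₗ σ = x • LinearMap.id := by
  constructor
  · rintro ⟨P, hPfin, hP, ι, π', h⟩
    haveI := hP
    haveI : Module.Projective T P := P.projective_of_module_projective
    obtain ⟨l, hl⟩ := Module.projective_lifting_property π π'.hom hπ
    refine ⟨l ∘ₗ ι.hom, ?_⟩
    ext m
    have h1 : π (l (ι.hom m)) = π'.hom (ι.hom m) := LinearMap.congr_fun hl (ι.hom m)
    simp only [LinearMap.coe_comp, Function.comp_apply, LinearMap.smul_apply, LinearMap.id_coe,
      id_eq, h1]
    exact apply_apply_eq_smul_of_comp_eq_smul_id h m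
  · rintro ⟨σ, hσ⟩
    refine ⟨ModuleCat.of T F₀, ‹_›, (IsProjective.iff_projective (R := T) F₀).mp ‹_›,
      ModuleCat.ofHom σ, ModuleCat.ofHom π, ?_⟩
    ext m
    have h1 : π (σ m) = x • m := by
      simpa using LinearMap.congr_fun hσ m
    simpa [ModuleCat.hom_comp, ModuleCat.hom_ofHom] using h1

/-- **The sandwich equation.**  For a presentation `F₁ →ρ F₀ →π M → 0` (`ρ`, `π` exact, `π`
surjective) with `F₀` projective: `x • 𝟙 M` lifts along `π` iff `ρ ∘ β ∘ ρ = -(x • ρ)` for some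
`β : F₀ → F₁`.  (`⇒`: `σ π - x • 𝟙` maps into `ker π = range ρ`, lift it along `ρ` to `β`;
`⇐`: `x • 𝟙 + ρ β` kills `range ρ = ker π`, so it factors as `σ ∘ π`, and `π σ π = x • π`.)
[folklore] -/
theorem exists_comp_eq_smul_id_iff_exists_sandwich [Module.Projective T F₀] (x : T)
    (ρ : F₁ →ₗ[T] F₀) (π : F₀ →ₗ[T] M) (hex : Function.Exact ρ π)
    (hπ : Function.Surjective π) :
    (∃ σ : M →ₗ[T] F₀, π ∘ₗ σ = x • LinearMap.id) ↔
      ∃ β : F₀ →ₗ[T] F₁, ρ ∘ₗ β ∘ₗ ρ = -(x • ρ) := by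
  constructor
  · rintro ⟨σ, hσ⟩
    have hmem : ∀ v : F₀, (σ ∘ₗ π - x • (LinearMap.id : F₀ →ₗ[T] F₀)) v ∈ LinearMap.range ρ := by
      intro v
      rw [← hex.linearMap_ker_eq, LinearMap.mem_ker]
      have h1 : π (σ (π v)) = x • π v := by
        simpa using LinearMap.congr_fun hσ (π v)
      simp only [LinearMap.sub_apply, LinearMap.coe_comp, Function.comp_apply, LinearMap.smul_apply,
        LinearMap.id_coe, id_eq, map_sub, map_smul, h1, sub_self]
    obtain ⟨β, hβ⟩ := Module.projective_lifting_property ρ.rangeRestrict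
      (LinearMap.codRestrict (LinearMap.range ρ) (σ ∘ₗ π - x • LinearMap.id) hmem)
      ρ.surjective_rangeRestrict
    refine ⟨β, ?_⟩
    have hρβ : ρ ∘ₗ β = σ ∘ₗ π - x • LinearMap.id := by
      ext v
      have h1 := congrArg Subtype.val (LinearMap.congr_fun hβ v)
      simpa using h1
    have hπρ : π ∘ₗ ρ = 0 := hex.linearMap_comp_eq_zero
    calc ρ ∘ₗ β ∘ₗ ρ = (ρ ∘ₗ β) ∘ₗ ρ := (LinearMap.comp_assoc _ _ _).symm
      _ = (σ ∘ₗ π - x • LinearMap.id) ∘ₗ ρ := by rw [hρβ]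
      _ = σ ∘ₗ (π ∘ₗ ρ) - x • ρ := by
          rw [LinearMap.sub_comp, LinearMap.smul_comp, LinearMap.id_comp, LinearMap.comp_assoc]
      _ = -(x • ρ) := by rw [hπρ, LinearMap.comp_zero, zero_sub]
  · rintro ⟨β, hβ⟩
    set α : F₀ →ₗ[T] F₀ := x • LinearMap.id + ρ ∘ₗ β with hα
    have hαρ : α ∘ₗ ρ = 0 := by
      rw [hα, LinearMap.add_comp, LinearMap.smul_comp, LinearMap.id_comp, LinearMap.comp_assoc, hβ,
        add_neg_cancel]
    have hker : LinearMap.ker π ≤ LinearMap.ker α := by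
      rw [hex.linearMap_ker_eq]
      rintro _ ⟨w, rfl⟩
      rw [LinearMap.mem_ker, ← LinearMap.comp_apply, hαρ, LinearMap.zero_apply]
    let σ : M →ₗ[T] F₀ :=
      (LinearMap.ker π).liftQ α hker ∘ₗ (π.quotKerEquivOfSurjective hπ).symm.toLinearMap
    have hσπ : σ ∘ₗ π = α := by
      ext v
      simp only [σ, LinearMap.coe_comp, Function.comp_apply, LinearEquiv.coe_coe,
        LinearMap.quotKerEquivOfSurjective_symm_apply, Submodule.liftQ_apply]
    refine ⟨σ, ?_⟩
    rw [← LinearMap.cancel_right hπ, LinearMap.comp_assoc, hσπ, hα, LinearMap.comp_add,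
      LinearMap.comp_smul, LinearMap.comp_id, ← LinearMap.comp_assoc, hex.linearMap_comp_eq_zero,
      LinearMap.zero_comp, add_zero, LinearMap.smul_comp, LinearMap.id_comp]

end Presentation

/-! ## (D) Descent of solvability along a faithfully flat algebra -/

section Descent

variable {T : Type u} [CommRing T] (S : Type u) [CommRing S] [Algebra T S]

/-- **Membership in the image of a linear map descends along a faithfully flat algebra**: if
`1 ⊗ y` lies in the range of `Γ ⊗ S`, then `y` lies in the range of `Γ` — the class of `y` in
`W ⧸ range Γ` dies after `S ⊗_T -`, hence is zero (Mathlib `Module.FaithfullyFlat.one_tmul_eq_zero_iff`).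
[folklore] -/
theorem mem_range_of_one_tmul_mem_range_baseChange [Module.FaithfullyFlat T S] {V W : Type u}
    [AddCommGroup V] [Module T V] [AddCommGroup W] [Module T W] (Γ : V →ₗ[T] W) {y : W}
    (h : (1 : S) ⊗ₜ[T] y ∈ LinearMap.range (Γ.baseChange S)) : y ∈ LinearMap.range Γ := by
  obtain ⟨b, hb⟩ := h
  have h0 : ((LinearMap.range Γ).mkQ.baseChange S) ((1 : S) ⊗ₜ[T] y) = 0 := by
    rw [← hb, ← LinearMap.comp_apply, ← LinearMap.baseChange_comp, LinearMap.range_mkQ_comp,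
      LinearMap.baseChange_zero, LinearMap.zero_apply]
  rw [LinearMap.baseChange_tmul, Module.FaithfullyFlat.one_tmul_eq_zero_iff, Submodule.mkQ_apply,
    Submodule.Quotient.mk_eq_zero] at h0
  exact h0

/-- Mathlib's base-change map for linear maps out of a finite free module
(`IsBaseChange.linearMapLeftRightHom` for the standard base changes `S ⊗_T -`) IS
`LinearMap.baseChange`. [folklore] -/
theorem linearMapLeftRightHom_mk_eq_baseChange {F F' : Type u} [AddCommGroup F] [Module T F]
    [AddCommGroup F'] [Module T F'] (f : F →ₗ[T] F') :
    IsBaseChange.linearMapLeftRightHom (TensorProduct.isBaseChange T F S)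
        (TensorProduct.mk T S F' 1) f = f.baseChange S :=
  (TensorProduct.isBaseChange T F S).algHom_ext _ _ fun m => by
    rw [IsBaseChange.linearMapLeftRightHom_comp_apply, TensorProduct.mk_apply,
      TensorProduct.mk_apply, LinearMap.baseChange_tmul]

/-- **Descent of the sandwich equation.**  For `S` faithfully flat over `T` and `ρ : F₁ → F₀` a map
of finite free `T`-modules: if `ρ_S ∘ β' ∘ ρ_S = -(x • ρ_S)` is solvable over `S` (`ρ_S = ρ ⊗ S`),
then `ρ ∘ β ∘ ρ = -(x • ρ)` is solvable over `T`.  The sandwich map `β ↦ ρ β ρ` is `T`-linear between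
Hom-modules of finite free modules, which commute with base change (Mathlib
`IsBaseChange.linearMapLeftRight`) compatibly with the sandwich; conclude by
`mem_range_of_one_tmul_mem_range_baseChange`. [folklore] -/
theorem exists_sandwich_of_baseChange [Module.FaithfullyFlat T S] {F₀ F₁ : Type u}
    [AddCommGroup F₀] [Module T F₀] [AddCommGroup F₁] [Module T F₁]
    [Module.Free T F₀] [Module.Finite T F₀] [Module.Free T F₁] [Module.Finite T F₁]
    (x : T) (ρ : F₁ →ₗ[T] F₀)
    (h : ∃ β' : S ⊗[T] F₀ →ₗ[S] S ⊗[T] F₁,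
      ρ.baseChange S ∘ₗ β' ∘ₗ ρ.baseChange S = -(x • ρ.baseChange S)) :
    ∃ β : F₀ →ₗ[T] F₁, ρ ∘ₗ β ∘ₗ ρ = -(x • ρ) := by
  obtain ⟨β', hβ'⟩ := h
  -- the sandwich map `β ↦ ρ ∘ β ∘ ρ`
  let Γ : (F₀ →ₗ[T] F₁) →ₗ[T] (F₁ →ₗ[T] F₀) :=
    (LinearMap.lcomp T F₀ ρ) ∘ₗ (LinearMap.compRight T ρ)
  have hΓ : ∀ β : F₀ →ₗ[T] F₁, Γ β = ρ ∘ₗ β ∘ₗ ρ := fun β => rfl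
  suffices hy : -(x • ρ) ∈ LinearMap.range Γ by
    obtain ⟨β, hβ⟩ := hy
    exact ⟨β, by rw [← hΓ, hβ]⟩
  apply mem_range_of_one_tmul_mem_range_baseChange S Γ
  -- the base-change isomorphisms of the two Hom-modules
  let eV : S ⊗[T] (F₀ →ₗ[T] F₁) ≃ₗ[S] (S ⊗[T] F₀ →ₗ[S] S ⊗[T] F₁) :=
    (IsBaseChange.linearMapLeftRight (TensorProduct.isBaseChange T F₀ S)
      (TensorProduct.isBaseChange T F₁ S)).equiv
  let eW : S ⊗[T] (F₁ →ₗ[T] F₀) ≃ₗ[S] (S ⊗[T] F₁ →ₗ[S] S ⊗[T] F₀) :=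
    (IsBaseChange.linearMapLeftRight (TensorProduct.isBaseChange T F₁ S)
      (TensorProduct.isBaseChange T F₀ S)).equiv
  have heV : ∀ (s : S) (β : F₀ →ₗ[T] F₁), eV (s ⊗ₜ[T] β) = s • β.baseChange S := fun s β => by
    simp only [eV, IsBaseChange.equiv_tmul, linearMapLeftRightHom_mk_eq_baseChange]
  have heW : ∀ (s : S) (γ : F₁ →ₗ[T] F₀), eW (s ⊗ₜ[T] γ) = s • γ.baseChange S := fun s γ => by
    simp only [eW, IsBaseChange.equiv_tmul, linearMapLeftRightHom_mk_eq_baseChange]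
  -- compatibility of the sandwich with the base change
  have hsq : ∀ b : S ⊗[T] (F₀ →ₗ[T] F₁),
      eW (Γ.baseChange S b) = ρ.baseChange S ∘ₗ eV b ∘ₗ ρ.baseChange S := by
    intro b
    induction b using TensorProduct.induction_on with
    | zero => simp only [map_zero, LinearMap.zero_comp, LinearMap.comp_zero]
    | add b₁ b₂ h₁ h₂ => simp only [map_add, h₁, h₂, LinearMap.add_comp, LinearMap.comp_add]
    | tmul s β =>
      rw [LinearMap.baseChange_tmul, heW, heV, hΓ, LinearMap.baseChange_comp,
        LinearMap.baseChange_comp, LinearMap.smul_comp, LinearMap.comp_smul]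
  refine ⟨eV.symm β', eW.injective ?_⟩
  rw [hsq, LinearEquiv.apply_symm_apply, hβ', heW, one_smul, LinearMap.baseChange_neg,
    LinearMap.baseChange_smul]

end Descent

/-! ## (D1) Faithfully flat descent of stable annihilation -/

/-- **(D1) Stable annihilation descends along a faithfully flat algebra.**  For `S` faithfully flat
over `T`, `M` a finitely presented `T`-module and `x ∈ T`: if `algebraMap T S x` stably annihilates
`S ⊗_T M` over `S`, then `x` stably annihilates `M` over `T`.  Proof: choose a finite presentation
`F₁ →ρ F₀ →π M → 0`; by (P) (over `S`, for the base-changed presentation, which stays a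
presentation by right exactness of `S ⊗_T -`) the hypothesis is the solvability of
`ρ_S β' ρ_S = -x ρ_S` over `S`; by (D) it is solvable over `T`; by (P) again `x ∈ s̲ann(M)`.
(Declared in the namespace of `StablyAnnihilates`, so that `hS.of_faithfullyFlat_baseChange x M`
works by dot notation.) [folklore; vocabulary of IyengarTakahashi2014, Remark 2.13] -/
theorem _root_.Summit.ResolutionOfSingularities.ResolutionOfSingularities.Theorems.NoZeno.SandwichCluster.StablyAnnihilates.of_faithfullyFlat_baseChange
    {T S : Type u} [CommRing T] [CommRing S]
    [Algebra T S] [Module.FaithfullyFlat T S] (x : T) (M : ModuleCat.{u} T)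
    [Module.FinitePresentation T M]
    (h : StablyAnnihilates S (algebraMap T S x) (ModuleCat.of S (S ⊗[T] M))) :
    StablyAnnihilates T x M := by
  -- a finite presentation `(Fin k → T) →ρ (Fin n → T) →π M → 0`
  obtain ⟨n, K, e, hK⟩ := Module.FinitePresentation.exists_fin T M
  haveI : Module.Finite T K := Module.Finite.iff_fg.mpr hK
  obtain ⟨k, f, hf⟩ := Module.Finite.exists_fin' T K
  let ρ : (Fin k → T) →ₗ[T] (Fin n → T) := K.subtype ∘ₗ f
  let π : (Fin n → T) →ₗ[T] M := (e.symm : ((Fin n → T) ⧸ K) →ₗ[T] M) ∘ₗ K.mkQ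
  have hπ : Function.Surjective π := e.symm.surjective.comp K.mkQ_surjective
  have hex : Function.Exact ρ π := by
    rw [LinearMap.exact_iff, LinearEquiv.ker_comp, Submodule.ker_mkQ, LinearMap.range_comp,
      LinearMap.range_eq_top.mpr hf, Submodule.map_top, Submodule.range_subtype]
  -- its base change is a presentation of `S ⊗ M`
  have hexS : Function.Exact (ρ.baseChange S) (π.baseChange S) := by
    rw [LinearMap.baseChange_eq_ltensor, LinearMap.baseChange_eq_ltensor]
    exact lTensor_exact S hex hπ
  have hπS : Function.Surjective (π.baseChange S) := by
    rw [LinearMap.baseChange_eq_ltensor]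
    exact LinearMap.lTensor_surjective S hπ
  -- over `S`: the sandwich equation is solvable
  have h1 := (stablyAnnihilates_iff_exists_comp_eq_smul_id (algebraMap T S x) (π.baseChange S)
    hπS).mp h
  obtain ⟨β', hβ'⟩ := (exists_comp_eq_smul_id_iff_exists_sandwich (algebraMap T S x)
    (ρ.baseChange S) (π.baseChange S) hexS hπS).mp h1
  have h2 : ∃ β' : S ⊗[T] (Fin n → T) →ₗ[S] S ⊗[T] (Fin k → T),
      ρ.baseChange S ∘ₗ β' ∘ₗ ρ.baseChange S = -(x • ρ.baseChange S) :=
    ⟨β', by rw [hβ', algebraMap_smul]⟩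
  -- descend, and read the solution over `T` as a factorisation
  obtain ⟨β, hβ⟩ := exists_sandwich_of_baseChange S x ρ h2
  exact (stablyAnnihilates_iff_exists_comp_eq_smul_id x π hπ).mpr
    ((exists_comp_eq_smul_id_iff_exists_sandwich x ρ π hex hπ).mpr ⟨β, hβ⟩)

/-! ## (D2) Faithfully flat descent of `caⁿ⁺¹` and `ca` -/

/-- **(D2) `caⁿ⁺¹` descends along a faithfully flat map of noetherian rings (same index).**  For `T`,
`S` noetherian and `S` faithfully flat over `T`: `caⁿ⁺¹(S) ∩ T ⊆ caⁿ⁺¹(T)`, i.e.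
`(caⁿ⁺¹ S).comap (algebraMap T S) ≤ caⁿ⁺¹ T`.  By CA1 (`mem_cohomologyAnnihilatorOfDegree_succ_iff_forall_isSyzygy`)
it suffices that `x` stably annihilates every `n`-th syzygy `K` of a finitely generated `T`-module
`M`; `S ⊗ K` is an `n`-th syzygy of `S ⊗ M` (tree `IsSyzygy.baseChange`, `S` flat), so `algebraMap x`
stably annihilates it (CA1 over `S`), and (D1) descends this to `K` (finitely generated over
noetherian `T`, hence finitely presented). [folklore; IyengarTakahashi2014 §2 vocabulary] -/
theorem comap_cohomologyAnnihilatorOfDegree_succ_le_of_faithfullyFlat {T S : Type u} [CommRing T]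
    [CommRing S] [Algebra T S] [IsNoetherianRing T] [IsNoetherianRing S] [Module.FaithfullyFlat T S]
    (n : ℕ) :
    (cohomologyAnnihilatorOfDegree S (n + 1)).comap (algebraMap T S) ≤
      cohomologyAnnihilatorOfDegree T (n + 1) := by
  intro x hx
  rw [Ideal.mem_comap] at hx
  rw [mem_cohomologyAnnihilatorOfDegree_succ_iff_forall_isSyzygy]
  intro M K hM hK
  haveI := hM
  haveI : Module.Finite T K := finite_of_isSyzygy n hM hK
  haveI : Module.FinitePresentation T K := Module.finitePresentation_of_finite T K
  have hKS : IsSyzygy n (ModuleCat.of S (S ⊗[T] M)) (ModuleCat.of S (S ⊗[T] K)) :=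
    IsSyzygy.baseChange S n hK
  have hS : StablyAnnihilates S (algebraMap T S x) (ModuleCat.of S (S ⊗[T] K)) :=
    (mem_cohomologyAnnihilatorOfDegree_succ_iff_forall_isSyzygy (algebraMap T S x)).mp hx _ _
      (Module.Finite.base_change T S M) hKS
  exact StablyAnnihilates.of_faithfullyFlat_baseChange (S := S) x K hS

/-- **(D2, `ca` form)** For `T`, `S` noetherian and `S` faithfully flat over `T`: `ca(S) ∩ T ⊆ ca(T)`
(`ca = ⋃ₙ caⁿ`, and `caⁿ ⊆ caⁿ⁺¹`). [folklore] -/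
theorem comap_cohomologyAnnihilator_le_of_faithfullyFlat {T S : Type u} [CommRing T] [CommRing S]
    [Algebra T S] [IsNoetherianRing T] [IsNoetherianRing S] [Module.FaithfullyFlat T S] :
    (cohomologyAnnihilator S).comap (algebraMap T S) ≤ cohomologyAnnihilator T := by
  intro x hx
  rw [Ideal.mem_comap, mem_cohomologyAnnihilator_iff] at hx
  obtain ⟨n, hn⟩ := hx
  rw [mem_cohomologyAnnihilator_iff]
  refine ⟨n + 1, comap_cohomologyAnnihilatorOfDegree_succ_le_of_faithfullyFlat (S := S) n ?_⟩
  rw [Ideal.mem_comap]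
  exact cohomologyAnnihilatorOfDegree_mono (Nat.le_succ n) hn

/-- **(D2, elementwise)** For `T`, `S` noetherian, `S` faithfully flat over `T`, and `x ∈ T` with
`algebraMap T S x ∈ caⁿ⁺¹(S)`: `x ∈ caⁿ⁺¹(T)`. [folklore] -/
theorem mem_cohomologyAnnihilatorOfDegree_succ_of_faithfullyFlat {T S : Type u} [CommRing T]
    [CommRing S] [Algebra T S] [IsNoetherianRing T] [IsNoetherianRing S] [Module.FaithfullyFlat T S]
    {n : ℕ} {x : T} (hx : algebraMap T S x ∈ cohomologyAnnihilatorOfDegree S (n + 1)) :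
    x ∈ cohomologyAnnihilatorOfDegree T (n + 1) :=
  comap_cohomologyAnnihilatorOfDegree_succ_le_of_faithfullyFlat (S := S) n (Ideal.mem_comap.mpr hx)

/-! ## (D3) Flat local homomorphisms and étale neighbourhoods -/

/-- **(D3) `caⁿ⁺¹` descends along a flat local homomorphism of noetherian local rings** (same index):
such a map is faithfully flat (Mathlib `Module.FaithfullyFlat.of_flat_of_isLocalHom`), so (D2)
applies.  This covers every (pointed) étale neighbourhood `T' → E_𝔮` of a noetherian local `T'` and the
maps `T' → T'ʰ`, `T' → T̂'` whenever the target is known to be noetherian. [folklore] -/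
theorem comap_cohomologyAnnihilatorOfDegree_succ_le_of_flat_of_isLocalHom {T S : Type u} [CommRing T]
    [CommRing S] [Algebra T S] [IsNoetherianRing T] [IsNoetherianRing S] [IsLocalRing T]
    [IsLocalRing S] [Module.Flat T S] [IsLocalHom (algebraMap T S)] (n : ℕ) :
    (cohomologyAnnihilatorOfDegree S (n + 1)).comap (algebraMap T S) ≤
      cohomologyAnnihilatorOfDegree T (n + 1) := by
  haveI : Module.FaithfullyFlat T S := Module.FaithfullyFlat.of_flat_of_isLocalHom
  exact comap_cohomologyAnnihilatorOfDegree_succ_le_of_faithfullyFlat n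

/-- **(D3, étale neighbourhoods)** `caⁿ⁺¹` descends along every pointed ÉTALE NEIGHBOURHOOD of a
noetherian local ring (same index): for `T` local noetherian, `E` an étale `T`-algebra, `𝔮` a prime
of `E` over the closed point of `T` and `S = E_𝔮` (any localisation of `E` at `𝔮`, with the composite
algebra structure `T → E → S`): `caⁿ⁺¹(S) ∩ T ⊆ caⁿ⁺¹(T)`.  Indeed `S` is local, noetherian (`E` is of
finite type over `T`), flat over `T` (étale ⇒ smooth ⇒ flat, and localisations are flat), and
`T → S` is a local homomorphism (`𝔪_S ∩ E = 𝔮`, `𝔮 ∩ T = 𝔪_T`); apply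
`comap_cohomologyAnnihilatorOfDegree_succ_le_of_flat_of_isLocalHom`.  This is the model
`T₂ := E_𝔮` of the descent conjunct of ORDER w44b-o8's step dual cover. [folklore] -/
theorem comap_cohomologyAnnihilatorOfDegree_succ_le_of_etale_neighbourhood {T E S : Type u}
    [CommRing T] [CommRing E] [CommRing S] [Algebra T E] [Algebra E S] [Algebra T S]
    [IsScalarTower T E S] [IsNoetherianRing T] [IsLocalRing T] [Algebra.Etale T E]
    (𝔮 : Ideal E) [𝔮.IsPrime] [IsLocalization.AtPrime S 𝔮]
    (h𝔮 : 𝔮.under T = IsLocalRing.maximalIdeal T) (n : ℕ) :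
    (cohomologyAnnihilatorOfDegree S (n + 1)).comap (algebraMap T S) ≤
      cohomologyAnnihilatorOfDegree T (n + 1) := by
  haveI : IsLocalRing S := IsLocalization.AtPrime.isLocalRing S 𝔮
  haveI : IsNoetherianRing E := Algebra.FiniteType.isNoetherianRing T E
  haveI : IsNoetherianRing S := IsLocalization.isNoetherianRing 𝔮.primeCompl S inferInstance
  haveI : Module.Flat E S := IsLocalization.flat S 𝔮.primeCompl
  haveI : Module.Flat T S := Module.Flat.trans T E S
  haveI : IsLocalHom (algebraMap T S) := by
    refine ((IsLocalRing.local_hom_TFAE (algebraMap T S)).out 0 4).mpr ?_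
    have h1 : (IsLocalRing.maximalIdeal S).under T = IsLocalRing.maximalIdeal T := by
      rw [← Ideal.under_under (B := E) (IsLocalRing.maximalIdeal S),
        IsLocalization.AtPrime.under_maximalIdeal S 𝔮, h𝔮]
    exact h1
  exact comap_cohomologyAnnihilatorOfDegree_succ_le_of_flat_of_isLocalHom n

/-- **(D3, étale neighbourhoods, `ca` form)** In the setting of
`comap_cohomologyAnnihilatorOfDegree_succ_le_of_etale_neighbourhood`: `ca(E_𝔮) ∩ T ⊆ ca(T)`.
[folklore] -/
theorem comap_cohomologyAnnihilator_le_of_etale_neighbourhood {T E S : Type u}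
    [CommRing T] [CommRing E] [CommRing S] [Algebra T E] [Algebra E S] [Algebra T S]
    [IsScalarTower T E S] [IsNoetherianRing T] [IsLocalRing T] [Algebra.Etale T E]
    (𝔮 : Ideal E) [𝔮.IsPrime] [IsLocalization.AtPrime S 𝔮]
    (h𝔮 : 𝔮.under T = IsLocalRing.maximalIdeal T) :
    (cohomologyAnnihilator S).comap (algebraMap T S) ≤ cohomologyAnnihilator T := by
  intro x hx
  rw [Ideal.mem_comap, mem_cohomologyAnnihilator_iff] at hx
  obtain ⟨n, hn⟩ := hx
  rw [mem_cohomologyAnnihilator_iff]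
  refine ⟨n + 1, comap_cohomologyAnnihilatorOfDegree_succ_le_of_etale_neighbourhood (S := S) 𝔮 h𝔮 n ?_⟩
  rw [Ideal.mem_comap]
  exact cohomologyAnnihilatorOfDegree_mono (Nat.le_succ n) hn

end Summit.ResolutionOfSingularities.ResolutionOfSingularities.Theorems.HomologicalConductor.PersistenceFaithfullyFlatDescent

end
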